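import Mathlib
import Summits.Ventures.Crystal3D.Theorems.StickyWulffConstantTextureLiminfTexShadowDefs
import Literature.Analysis.Convexity.AnisotropicPerimeterPolytopeUnion
import HarnessLib

/-!
# Line `TexShadow` (crux `TextureLiminf`, stmt-Ventures-19483): groups of cells (grains) under the facet calculus

HONEST FRAMING. Part of the venture `Summits/Ventures/Crystal3D` (cell `crystal3d-full`), route
`route-Ventures-StickyWulffConstant`, crux `TextureLiminf` (stmt-Ventures-19483), line `TexShadow`.
Corollaries of clause (B) of the landed `stub_polytopeCalculus`
(`Literature.Analysis.Convexity.toReal_anisotropicPerimeter_iUnion_openHPolytope`) in the route's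
vocabulary (`per`, `polytope`, `supportFn`, `facetArea` of `…TexShadowDefs.lean`), for the grains of a
polyhedral texture, which are unions of (disjoint, bounded, open) convex cells:
* `per_biUnion_polytope` — clause (B) for the SUB-family indexed by any `S ⊆ Fin k` (the other cells are
  masked by the empty polytope `polytope {(0, -1)} = ∅`);
* `per_add_per_sub_per_union_groups` — for disjoint groups `S, T` of cells,
  `per K (⋃_S) + per K (⋃_T) − per K (⋃_{S ∪ T})` is the sum over CROSS pairs of the facet contact terms
  `(h_K(ν) + h_K(−ν)) · facetArea` (so the route's `ι_K(⋃_S, ⋃_T)` is half of it): the interface energy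
  between two grains is a facet sum.
WHAT THIS IS NOT: a registered stub; rung F-C1 not moved.
-/

noncomputable section

open scoped BigOperators InnerProductSpace ENNReal
open MeasureTheory

namespace Summit.Ventures.Crystal3D.Cruxes.TextureLiminf.TexShadow

open Literature.Analysis.Convexity

/-- The `H`-representation `{(0, -1)}` describes the EMPTY open polytope (`⟪0, x⟫ < -1` never holds). -/
theorem polytope_empty_rep : polytope ({((0 : E3), (-1 : ℝ))} : Finset (E3 × ℝ)) = ∅ := by
  ext x
  simp [polytope]

/-- **Clause (B) for a sub-family of cells** (masking the other cells by empty polytopes): for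
`S ⊆ Fin k`, `per K (⋃_{i ∈ S} Q_i) = Σ_{i ∈ S} per K Q_i − Σ_{i<j in S} (h_K(ν_ij) + h_K(−ν_ij))·facetArea`. -/
theorem per_biUnion_polytope (K : Set E3) (hKc : IsCompact K) (hK : Convex ℝ K) (hK0 : (0 : E3) ∈ K)
    {k : ℕ} (H : Fin k → Finset (E3 × ℝ)) (ν : Fin k → Fin k → E3)
    (hbd : ∀ i, Bornology.IsBounded (polytope (H i)))
    (hdisj : ∀ i j, i ≠ j → Disjoint (polytope (H i)) (polytope (H j)))
    (hν : ∀ i j, i ≠ j → ‖ν i j‖ = 1 ∧ ∃ b : ℝ,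
      closure (polytope (H i)) ∩ closure (polytope (H j)) ⊆ {x | ⟪ν i j, x⟫_ℝ = b})
    (S : Finset (Fin k)) :
    per K (⋃ i ∈ S, polytope (H i)) =
      ∑ i ∈ S, per K (polytope (H i)) -
        ∑ i ∈ S, ∑ j ∈ S, (if i < j then (supportFn K (ν i j) + supportFn K (-ν i j)) *
          facetArea (closure (polytope (H i)) ∩ closure (polytope (H j))) (ν i j) else 0) := by
  classical
  -- the masked family
  set H' : Fin k → Finset (E3 × ℝ) := fun i => if i ∈ S then H i else {((0 : E3), (-1 : ℝ))} with hH'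
  set Q' : Fin k → Set E3 := fun i => if i ∈ S then polytope (H i) else ∅ with hQ'def
  have hQ'S : ∀ i ∈ S, Q' i = polytope (H i) := fun i hi => by simp [hQ'def, hi]
  have hQ'n : ∀ i ∉ S, Q' i = ∅ := fun i hi => by simp [hQ'def, hi]
  have hQ' : ∀ i, Q' i = ⋂ p ∈ H' i, {x : E3 | ⟪p.1, x⟫_ℝ < p.2} := by
    intro i
    by_cases hi : i ∈ S
    · rw [hQ'S i hi]; simp only [hH', hi, if_true]; rfl
    · rw [hQ'n i hi]; simp only [hH', hi, if_false]
      exact (polytope_empty_rep).symm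
  have hbd' : ∀ i, Bornology.IsBounded (Q' i) := by
    intro i; by_cases hi : i ∈ S
    · rw [hQ'S i hi]; exact hbd i
    · rw [hQ'n i hi]; exact Bornology.isBounded_empty
  have hdisj' : ∀ i j, i ≠ j → Disjoint (Q' i) (Q' j) := by
    intro i j hij
    by_cases hi : i ∈ S
    · by_cases hj : j ∈ S
      · rw [hQ'S i hi, hQ'S j hj]; exact hdisj i j hij
      · rw [hQ'n j hj]; exact disjoint_bot_right
    · rw [hQ'n i hi]; exact disjoint_bot_left
  have hcl' : ∀ i j, closure (Q' i) ∩ closure (Q' j) ⊆ closure (polytope (H i)) ∩ closure (polytope (H j)) := by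
    intro i j
    refine Set.inter_subset_inter (closure_mono ?_) (closure_mono ?_)
    · by_cases hi : i ∈ S
      · rw [hQ'S i hi]
      · rw [hQ'n i hi]; exact Set.empty_subset _
    · by_cases hj : j ∈ S
      · rw [hQ'S j hj]
      · rw [hQ'n j hj]; exact Set.empty_subset _
  have hν' : ∀ i j, i ≠ j → ‖ν i j‖ = 1 ∧ ∃ b : ℝ,
      closure (Q' i) ∩ closure (Q' j) ⊆ {x : E3 | ⟪ν i j, x⟫_ℝ = b} := by
    intro i j hij
    obtain ⟨h1, b, hb⟩ := hν i j hij
    exact ⟨h1, b, (hcl' i j).trans hb⟩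
  have hB := toReal_anisotropicPerimeter_iUnion_openHPolytope H' Q' hQ' ν hbd' hdisj' hν' hKc hK hK0
  -- translate back
  have hU : (⋃ i, Q' i) = ⋃ i ∈ S, polytope (H i) := by
    ext x
    simp only [Set.mem_iUnion]
    constructor
    · rintro ⟨i, hx⟩
      by_cases hi : i ∈ S
      · exact ⟨i, hi, by rwa [hQ'S i hi] at hx⟩
      · rw [hQ'n i hi] at hx; exact hx.elim
    · rintro ⟨i, hi, hx⟩
      exact ⟨i, by rwa [hQ'S i hi]⟩
  simp only [per, perK_eq_anisotropicPerimeter, supportFn, facetArea]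
  rw [← hU, hB]
  -- the cell sum
  have hcell : ∑ i, (anisotropicPerimeter K (Q' i)).toReal =
      ∑ i ∈ S, (anisotropicPerimeter K (polytope (H i))).toReal := by
    rw [← Finset.sum_subset (Finset.subset_univ S) (fun i _ hi => by
      rw [hQ'n i hi, anisotropicPerimeter_of_volume_eq_zero (by simp), ENNReal.toReal_zero])]
    exact Finset.sum_congr rfl fun i hi => by rw [hQ'S i hi]
  -- the pair sum: masked pairs vanish
  have hterm : ∀ i j, (if i < j then
      (sSup ((fun y : E3 => ⟪y, ν i j⟫_ℝ) '' K) + sSup ((fun y : E3 => ⟪y, -ν i j⟫_ℝ) '' K)) *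
        (volume {x : E3 | ∃ y ∈ closure (Q' i) ∩ closure (Q' j),
          ∃ t ∈ Set.Icc (0 : ℝ) 1, x = y + t • ν i j}).toReal else 0) =
      (if i ∈ S ∧ j ∈ S then (if i < j then
        (sSup ((fun y : E3 => ⟪y, ν i j⟫_ℝ) '' K) + sSup ((fun y : E3 => ⟪y, -ν i j⟫_ℝ) '' K)) *
          (volume {x : E3 | ∃ y ∈ closure (polytope (H i)) ∩ closure (polytope (H j)),
            ∃ t ∈ Set.Icc (0 : ℝ) 1, x = y + t • ν i j}).toReal else 0) else 0) := by
    intro i j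
    by_cases hij : i ∈ S ∧ j ∈ S
    · rw [if_pos hij, hQ'S i hij.1, hQ'S j hij.2]
    · rw [if_neg hij]
      split_ifs with hlt
      · have hempty : closure (Q' i) ∩ closure (Q' j) = ∅ := by
          rcases not_and_or.1 hij with h' | h'
          · rw [hQ'n i h', closure_empty, Set.empty_inter]
          · rw [hQ'n j h', closure_empty, Set.inter_empty]
        rw [hempty]; simp
      · rfl
  have hpair : ∑ i, ∑ j, (if i < j then
      (sSup ((fun y : E3 => ⟪y, ν i j⟫_ℝ) '' K) + sSup ((fun y : E3 => ⟪y, -ν i j⟫_ℝ) '' K)) *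
        (volume {x : E3 | ∃ y ∈ closure (Q' i) ∩ closure (Q' j),
          ∃ t ∈ Set.Icc (0 : ℝ) 1, x = y + t • ν i j}).toReal else 0) =
      ∑ i ∈ S, ∑ j ∈ S, (if i < j then
        (sSup ((fun y : E3 => ⟪y, ν i j⟫_ℝ) '' K) + sSup ((fun y : E3 => ⟪y, -ν i j⟫_ℝ) '' K)) *
          (volume {x : E3 | ∃ y ∈ closure (polytope (H i)) ∩ closure (polytope (H j)),
            ∃ t ∈ Set.Icc (0 : ℝ) 1, x = y + t • ν i j}).toReal else 0) := by
    simp only [hterm]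
    rw [← Finset.sum_subset (Finset.subset_univ S) (fun i _ hi => Finset.sum_eq_zero fun j _ => by
      rw [if_neg (fun h => hi h.1)])]
    refine Finset.sum_congr rfl fun i hi => ?_
    rw [← Finset.sum_subset (Finset.subset_univ S) (fun j _ hj => by rw [if_neg (fun h => hj h.2)])]
    exact Finset.sum_congr rfl fun j hj => by rw [if_pos ⟨hi, hj⟩]
  rw [hcell, hpair]

/-- **Interface between two disjoint groups of cells** (grains of a polyhedral texture): for disjoint
index sets `S, T`, `per K (⋃_S Q_i) + per K (⋃_T Q_i) − per K (⋃_{S ∪ T} Q_i)` is the sum over the CROSS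
pairs `i ∈ S, j ∈ T` of the facet contact term `(h_K(ν) + h_K(−ν))·facetArea(Q̄_i ∩ Q̄_j)` (taken with the
orientation data of the smaller index, as in clause (B)); i.e. the route's `ι_K(⋃_S, ⋃_T)` is half of it. -/
theorem per_add_per_sub_per_union_groups (K : Set E3) (hKc : IsCompact K) (hK : Convex ℝ K)
    (hK0 : (0 : E3) ∈ K) {k : ℕ} (H : Fin k → Finset (E3 × ℝ)) (ν : Fin k → Fin k → E3)
    (hbd : ∀ i, Bornology.IsBounded (polytope (H i)))
    (hdisj : ∀ i j, i ≠ j → Disjoint (polytope (H i)) (polytope (H j)))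
    (hν : ∀ i j, i ≠ j → ‖ν i j‖ = 1 ∧ ∃ b : ℝ,
      closure (polytope (H i)) ∩ closure (polytope (H j)) ⊆ {x | ⟪ν i j, x⟫_ℝ = b})
    (S T : Finset (Fin k)) (hST : Disjoint S T) :
    per K (⋃ i ∈ S, polytope (H i)) + per K (⋃ i ∈ T, polytope (H i)) -
        per K (⋃ i ∈ S ∪ T, polytope (H i)) =
      ∑ i ∈ S, ∑ j ∈ T, (if i < j then (supportFn K (ν i j) + supportFn K (-ν i j)) *
          facetArea (closure (polytope (H i)) ∩ closure (polytope (H j))) (ν i j)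
        else (supportFn K (ν j i) + supportFn K (-ν j i)) *
          facetArea (closure (polytope (H j)) ∩ closure (polytope (H i))) (ν j i)) := by
  classical
  obtain ⟨F, hF⟩ : ∃ F : Fin k → Fin k → ℝ, ∀ i j, (supportFn K (ν i j) + supportFn K (-ν i j)) *
      facetArea (closure (polytope (H i)) ∩ closure (polytope (H j))) (ν i j) = F i j := ⟨_, fun _ _ => rfl⟩
  have hS := per_biUnion_polytope K hKc hK hK0 H ν hbd hdisj hν S
  have hT := per_biUnion_polytope K hKc hK hK0 H ν hbd hdisj hν T
  have hU := per_biUnion_polytope K hKc hK hK0 H ν hbd hdisj hν (S ∪ T)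
  simp only [hF] at hS hT hU ⊢
  rw [hS, hT, hU, Finset.sum_union hST]
  -- expand the pair sum over `S ∪ T`
  have hexp : ∑ i ∈ S ∪ T, ∑ j ∈ S ∪ T, (if i < j then F i j else 0) =
      (∑ i ∈ S, ∑ j ∈ S, (if i < j then F i j else 0)) + (∑ i ∈ T, ∑ j ∈ T, (if i < j then F i j else 0)) +
        ((∑ i ∈ S, ∑ j ∈ T, (if i < j then F i j else 0)) + ∑ i ∈ T, ∑ j ∈ S, (if i < j then F i j else 0)) := by
    rw [Finset.sum_union hST]
    simp only [Finset.sum_union hST]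
    rw [Finset.sum_add_distrib, Finset.sum_add_distrib]
    ring
  rw [hexp]
  have hswap : ∑ i ∈ T, ∑ j ∈ S, (if i < j then F i j else 0) = ∑ i ∈ S, ∑ j ∈ T, (if j < i then F j i else 0) :=
    Finset.sum_comm
  rw [hswap]
  have hcomb : ∀ i ∈ S, ∀ j ∈ T, ((if i < j then F i j else 0) + (if j < i then F j i else 0)) =
      (if i < j then F i j else F j i) := by
    intro i hi j hj
    have hne : i ≠ j := fun h => Finset.disjoint_left.1 hST hi (h ▸ hj)
    rcases lt_or_gt_of_ne hne with h | h
    · simp [h, lt_asymm h]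
    · simp [h, lt_asymm h]
  rw [← Finset.sum_add_distrib]
  have : ∀ i ∈ S, (∑ j ∈ T, (if i < j then F i j else 0)) + ∑ j ∈ T, (if j < i then F j i else 0) =
      ∑ j ∈ T, (if i < j then F i j else F j i) := by
    intro i hi
    rw [← Finset.sum_add_distrib]
    exact Finset.sum_congr rfl fun j hj => hcomb i hi j hj
  rw [Finset.sum_congr rfl this]
  ring

end Summit.Ventures.Crystal3D.Cruxes.TextureLiminf.TexShadow

end
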